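import Mathlib
import HarnessLib

/-!
# Theorem A, Fourier side: annular Schwartz kernels and their reproduction identity

Seat ns-poloidal-K2-p2 g6 (interim lead-of-record on crux K2 `PoloidalWindowRigidity` = stmt-NavierStokesRegularity-19708;
line `mixed_type` v1; item stmt-20428 `LrcModEntire`).  File 4a of the Lean port of **Theorem A** of memo
TH-ELLIPTIC-LIOUVILLE-g6 (semi-elliptic (TH) Liouville without slope bounds).

For `0 < ε < N` we build, on a finite-dimensional real inner product space `V`, the real Schwartz kernel

  `φ_{ε,N} := Re 𝓕⁻¹ A_{ε,N}`,  `A_{ε,N}(ξ) = χ(ξ/N) − χ(ξ/ε)`  (`χ` = the radial bump `bumpR 1 2`),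

whose Fourier transform lives in the annulus `ε ≤ ‖ξ‖ ≤ 2N`, together with the Schwartz kernels
`𝒦_j := 𝓕⁻¹ B_j`, `B_j(ξ) = ⟪ξ, b_j⟫ χ_{ε,N}(ξ) / (2πi‖ξ‖²)` (`b` the standard orthonormal basis, `χ_{ε,N} ≡ 1`
on the annulus, `≡ 0` near `0`), and prove the complex **reproduction identity**

* `PhiS_eq_sum` — `Φ(x) = ∑_j ∫ 𝒦_j(y) · ∂_{b_j} Φ(x − y) dy`, `Φ = 𝓕⁻¹ A_{ε,N}`; and `ofReal_re_PhiS` — `Φ` is real.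

Proof: on the Fourier side `∑_j (2πi ξ_j) B_j(ξ) = χ_{ε,N}(ξ)` and `χ_{ε,N} A_{ε,N} = A_{ε,N}`, so
`𝓕(∑_j ∂_jΦ ⋆ 𝒦_j) = 𝓕 Φ` in Schwartz space (`SchwartzMap.fourier_convolution`, `fourier_lineDerivOp_eq`), and
`𝓕` is injective there; realness of `Φ` comes from `A` being real and even.
Consumers: File 4a′ (`…RealKernels`: real parts and their integrability), File 4b (reverse Poincaré), File 4c (Theorem A).
WHAT THIS IS NOT: not a claim about Navier–Stokes — harmonic-analysis plumbing for a kinematic Liouville mechanism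
(bears_on LADDER-NS N0 via crux K2 = stmt-19708 / item 20428, mixed_type `stub_semiElliptic` ∩ (TH)).
-/

-- the summit and its single sub-problem share the name (CONVENTIONS §1)
set_option linter.dupNamespace false

noncomputable section

namespace Summit.NavierStokesRegularity.NavierStokesRegularity.Theorems.PoloidalWindowDoorPoloidalWindowRigidityFourierKernels

open Set Function Filter Topology MeasureTheory SchwartzMap Complex Real InnerProductSpace
open scoped RealInnerProductSpace FourierTransform LineDeriv ComplexConjugate

section Bumps

variable {V : Type*} [NormedAddCommGroup V]

/-! ### Radial bumps -/

/-- The radial bump `ξ ↦ smoothTransition ((R² − ‖ξ‖²)/(R² − r²))`: equal to `1` on `‖ξ‖ ≤ r` and to `0` on `‖ξ‖ ≥ R`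
(for `0 ≤ r < R`). -/
def bumpR (r R : ℝ) (ξ : V) : ℝ := Real.smoothTransition ((R ^ 2 - ‖ξ‖ ^ 2) / (R ^ 2 - r ^ 2))

/-- `bumpR = 1` on the inner ball. -/
theorem bumpR_eq_one {r R : ℝ} (hrR : r < R) (hr : 0 ≤ r) {ξ : V} (h : ‖ξ‖ ≤ r) : bumpR r R ξ = 1 := by
  unfold bumpR
  apply Real.smoothTransition.one_of_one_le
  have hd : 0 < R ^ 2 - r ^ 2 := by nlinarith
  rw [le_div_iff₀ hd, one_mul]
  have : ‖ξ‖ ^ 2 ≤ r ^ 2 := pow_le_pow_left₀ (norm_nonneg _) h 2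
  linarith

/-- `bumpR = 0` outside the outer ball. -/
theorem bumpR_eq_zero {r R : ℝ} (hrR : r < R) (hr : 0 ≤ r) {ξ : V} (h : R ≤ ‖ξ‖) : bumpR r R ξ = 0 := by
  unfold bumpR
  apply Real.smoothTransition.zero_of_nonpos
  have hd : 0 < R ^ 2 - r ^ 2 := by nlinarith
  apply div_nonpos_of_nonpos_of_nonneg _ hd.le
  have : R ^ 2 ≤ ‖ξ‖ ^ 2 := pow_le_pow_left₀ (by linarith) h 2
  linarith

/-- `bumpR` is even. -/
theorem bumpR_neg (r R : ℝ) (ξ : V) : bumpR r R (-ξ) = bumpR r R ξ := by simp [bumpR, norm_neg]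

/-! ### The annulus symbol and the cut-off -/

/-- The annulus symbol `A_{ε,N}(ξ) = χ(ξ/N) − χ(ξ/ε)` (`χ = bumpR 1 2`): vanishes on `‖ξ‖ ≤ ε` and on `‖ξ‖ ≥ 2N`. -/
def symA (ε N : ℝ) (ξ : V) : ℝ := bumpR N (2 * N) ξ - bumpR ε (2 * ε) ξ

/-- The cut-off `χ_{ε,N}`: `1` on `ε ≤ ‖ξ‖ ≤ 2N`, `0` on `‖ξ‖ ≤ ε/2` and on `‖ξ‖ ≥ 4N`. -/
def cutR (ε N : ℝ) (ξ : V) : ℝ := bumpR (2 * N) (4 * N) ξ - bumpR (ε / 2) ε ξ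

variable {ε N : ℝ}

/-- `A_{ε,N}` is even. -/
theorem symA_neg (ξ : V) : symA ε N (-ξ) = symA ε N ξ := by simp [symA, bumpR_neg]

/-- `A_{ε,N} = 0` on `‖ξ‖ ≤ ε`. -/
theorem symA_eq_zero_of_le (hε : 0 < ε) (hN : ε < N) {ξ : V} (h : ‖ξ‖ ≤ ε) : symA ε N ξ = 0 := by
  unfold symA
  rw [bumpR_eq_one (by linarith) (by linarith) (h.trans hN.le), bumpR_eq_one (by linarith) hε.le h, sub_self]

/-- `A_{ε,N} = 0` on `‖ξ‖ ≥ 2N`. -/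
theorem symA_eq_zero_of_ge (hε : 0 < ε) (hN : ε < N) {ξ : V} (h : 2 * N ≤ ‖ξ‖) : symA ε N ξ = 0 := by
  unfold symA
  rw [bumpR_eq_zero (by linarith) (by linarith) h, bumpR_eq_zero (by linarith) hε.le (by linarith), sub_self]

/-- `χ_{ε,N} = 1` on the annulus `ε ≤ ‖ξ‖ ≤ 2N`. -/
theorem cutR_eq_one (hε : 0 < ε) (hN : ε < N) {ξ : V} (h1 : ε ≤ ‖ξ‖) (h2 : ‖ξ‖ ≤ 2 * N) : cutR ε N ξ = 1 := by
  unfold cutR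
  rw [bumpR_eq_one (by linarith) (by linarith) h2, bumpR_eq_zero (by linarith) (by linarith) h1, sub_zero]

/-- `χ_{ε,N} = 0` on `‖ξ‖ ≤ ε/2`. -/
theorem cutR_eq_zero_of_le (hε : 0 < ε) (hN : ε < N) {ξ : V} (h : ‖ξ‖ ≤ ε / 2) : cutR ε N ξ = 0 := by
  unfold cutR
  rw [bumpR_eq_one (by linarith) (by linarith) (by linarith), bumpR_eq_one (by linarith) (by linarith) h, sub_self]

/-- `χ_{ε,N} = 0` on `‖ξ‖ ≥ 4N`. -/
theorem cutR_eq_zero_of_ge (hε : 0 < ε) (hN : ε < N) {ξ : V} (h : 4 * N ≤ ‖ξ‖) : cutR ε N ξ = 0 := by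
  unfold cutR
  rw [bumpR_eq_zero (by linarith) (by linarith) h, bumpR_eq_zero (by linarith) (by linarith) (by linarith), sub_self]

/-- `χ_{ε,N} · A_{ε,N} = A_{ε,N}`. -/
theorem cutR_mul_symA (hε : 0 < ε) (hN : ε < N) (ξ : V) : cutR ε N ξ * symA ε N ξ = symA ε N ξ := by
  by_cases h1 : ‖ξ‖ ≤ ε
  · rw [symA_eq_zero_of_le hε hN h1, mul_zero]
  by_cases h2 : 2 * N ≤ ‖ξ‖
  · rw [symA_eq_zero_of_ge hε hN h2, mul_zero]
  rw [cutR_eq_one hε hN (not_le.mp h1).le (not_le.mp h2).le, one_mul]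

end Bumps

/-! ### Smoothness, supports and the multipliers (inner product space) -/

section Inner

variable {V : Type*} [NormedAddCommGroup V] [InnerProductSpace ℝ V] {ε N : ℝ}

/-- `bumpR` is smooth. -/
theorem contDiff_bumpR (r R : ℝ) {n : ℕ∞} : ContDiff ℝ n (fun ξ : V => bumpR r R ξ) :=
  Real.smoothTransition.contDiff.comp ((contDiff_const.sub (contDiff_norm_sq ℝ)).div_const _)

/-- Scaling: `bumpR (cr) (cR) ξ = bumpR r R (ξ/c)`. -/
theorem bumpR_smul {r R c : ℝ} (hc : 0 < c) (ξ : V) : bumpR (c * r) (c * R) ξ = bumpR r R (c⁻¹ • ξ) := by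
  unfold bumpR
  congr 1
  rw [norm_smul, norm_inv, Real.norm_eq_abs, abs_of_pos hc]
  field_simp

/-- `A_{ε,N}` is smooth. -/
theorem contDiff_symA {n : ℕ∞} : ContDiff ℝ n (fun ξ : V => symA ε N ξ) :=
  (contDiff_bumpR _ _).sub (contDiff_bumpR _ _)

/-- `χ_{ε,N}` is smooth. -/
theorem contDiff_cutR {n : ℕ∞} : ContDiff ℝ n (fun ξ : V => cutR ε N ξ) :=
  (contDiff_bumpR _ _).sub (contDiff_bumpR _ _)

/-- The real multiplier `m_v(ξ) = ⟪ξ, v⟫ χ_{ε,N}(ξ) / (2π‖ξ‖²)`. -/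
def mulR (ε N : ℝ) (v : V) (ξ : V) : ℝ := ⟪ξ, v⟫ * cutR ε N ξ / (2 * π * ‖ξ‖ ^ 2)

/-- The multiplier `m_v` is smooth (the cut-off kills the singularity at `0`). -/
theorem contDiff_mulR (hε : 0 < ε) (hN : ε < N) (v : V) {n : ℕ∞} : ContDiff ℝ n (mulR ε N v) := by
  rw [contDiff_iff_contDiffAt]
  intro ξ
  by_cases h : ‖ξ‖ < ε / 2
  · have hev : mulR ε N v =ᶠ[𝓝 ξ] fun _ => 0 := by
      filter_upwards [(isOpen_lt continuous_norm continuous_const).mem_nhds h] with ξ' hξ'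
      simp [mulR, cutR_eq_zero_of_le hε hN (le_of_lt hξ')]
    exact contDiffAt_const.congr_of_eventuallyEq hev
  · have hξ : 2 * π * ‖ξ‖ ^ 2 ≠ 0 := by
      have : 0 < ‖ξ‖ := by linarith [not_lt.mp h]
      positivity
    exact ((contDiff_id.inner ℝ contDiff_const).mul contDiff_cutR).contDiffAt.div
      (contDiff_const.mul (contDiff_norm_sq ℝ)).contDiffAt hξ

variable [FiniteDimensional ℝ V]

/-- `A_{ε,N}` has compact support. -/
theorem hasCompactSupport_symA (hε : 0 < ε) (hN : ε < N) : HasCompactSupport (fun ξ : V => symA ε N ξ) := by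
  refine HasCompactSupport.of_support_subset_isCompact (isCompact_closedBall (0 : V) (2 * N)) fun ξ hξ => ?_
  rw [mem_closedBall_zero_iff]
  by_contra h
  exact hξ (symA_eq_zero_of_ge hε hN (not_le.mp h).le)

/-- The multiplier `m_v` has compact support. -/
theorem hasCompactSupport_mulR (hε : 0 < ε) (hN : ε < N) (v : V) : HasCompactSupport (mulR ε N v) := by
  refine HasCompactSupport.of_support_subset_isCompact (isCompact_closedBall (0 : V) (4 * N)) fun ξ hξ => ?_
  rw [mem_closedBall_zero_iff]
  by_contra h
  exact hξ (by simp [mulR, cutR_eq_zero_of_ge hε hN (not_le.mp h).le])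

/-- `∑_j 2π ⟪ξ, b_j⟫ m_{b_j}(ξ) = χ_{ε,N}(ξ)` for the standard orthonormal basis `b`. -/
theorem sum_inner_mul_mulR (hε : 0 < ε) (hN : ε < N) (ξ : V) :
    ∑ j, 2 * π * ⟪ξ, stdOrthonormalBasis ℝ V j⟫ * mulR ε N (stdOrthonormalBasis ℝ V j) ξ = cutR ε N ξ := by
  by_cases hξ : ξ = 0
  · subst hξ
    simp [mulR, cutR_eq_zero_of_le hε hN (show ‖(0 : V)‖ ≤ ε / 2 by simp; linarith)]
  have hn : ‖ξ‖ ^ 2 ≠ 0 := by positivity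
  have : ∀ j, 2 * π * ⟪ξ, stdOrthonormalBasis ℝ V j⟫ * mulR ε N (stdOrthonormalBasis ℝ V j) ξ
      = ⟪ξ, stdOrthonormalBasis ℝ V j⟫ ^ 2 * (cutR ε N ξ / ‖ξ‖ ^ 2) := by
    intro j
    unfold mulR
    field_simp
  simp_rw [this]
  rw [← Finset.sum_mul, (stdOrthonormalBasis ℝ V).sum_sq_inner_left]
  field_simp

end Inner

/-! ### Schwartz packaging and the Fourier-side identity -/

section Fourier

variable (V : Type*) [NormedAddCommGroup V] [InnerProductSpace ℝ V] [FiniteDimensional ℝ V]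
  [MeasurableSpace V] [BorelSpace V] {ε N : ℝ}

/-- The complex annulus symbol as a Schwartz function. -/
def symAS (hε : 0 < ε) (hN : ε < N) : 𝓢(V, ℂ) :=
  ((hasCompactSupport_symA (V := V) hε hN).comp_left (g := fun r : ℝ => (r : ℂ)) Complex.ofReal_zero).toSchwartzMap
    (Complex.ofRealCLM.contDiff.comp contDiff_symA)

variable {V}


variable (V) in
/-- The complex multipliers `B_v = −i m_v` as Schwartz functions. -/
def symBS (hε : 0 < ε) (hN : ε < N) (v : V) : 𝓢(V, ℂ) :=
  ((hasCompactSupport_mulR hε hN v).comp_left (g := fun r : ℝ => -I * (r : ℂ)) (by simp)).toSchwartzMap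
    ((contDiff_const.mul (Complex.ofRealCLM.contDiff.comp (contDiff_mulR hε hN v))))

omit [MeasurableSpace V] [BorelSpace V] in
/-- Pointwise value of `symAS`. -/
theorem symAS_apply (hε : 0 < ε) (hN : ε < N) (ξ : V) : symAS V hε hN ξ = (symA ε N ξ : ℂ) := rfl

omit [MeasurableSpace V] [BorelSpace V] in
/-- Pointwise value of `symBS`. -/
theorem symBS_apply (hε : 0 < ε) (hN : ε < N) (v ξ : V) : symBS V hε hN v ξ = -I * (mulR ε N v ξ : ℂ) := rfl

omit [MeasurableSpace V] [BorelSpace V] in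
/-- The symbol identity `(∑_j 2πi ⟪ξ,b_j⟫ B_j(ξ)) A(ξ) = A(ξ)`. -/
theorem sum_symbol (hε : 0 < ε) (hN : ε < N) (ξ : V) :
    (∑ j, (2 * π * I * ⟪ξ, stdOrthonormalBasis ℝ V j⟫) * symBS V hε hN (stdOrthonormalBasis ℝ V j) ξ)
      * symAS V hε hN ξ = symAS V hε hN ξ := by
  have : ∀ j, (2 * π * I * ⟪ξ, stdOrthonormalBasis ℝ V j⟫) * symBS V hε hN (stdOrthonormalBasis ℝ V j) ξ
      = ((2 * π * ⟪ξ, stdOrthonormalBasis ℝ V j⟫ * mulR ε N (stdOrthonormalBasis ℝ V j) ξ : ℝ) : ℂ) := by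
    intro j
    rw [symBS_apply]
    push_cast
    ring_nf
    rw [Complex.I_sq]
    ring
  simp_rw [this]
  rw [← Complex.ofReal_sum, sum_inner_mul_mulR hε hN, symAS_apply, ← Complex.ofReal_mul, cutR_mul_symA hε hN]

omit [FiniteDimensional ℝ V] [MeasurableSpace V] [BorelSpace V] in
/-- `ξ ↦ ⟪ξ, m⟫` has temperate growth. -/
theorem hasTemperateGrowth_inner_left (m : V) : (fun ξ : V => ⟪ξ, m⟫).HasTemperateGrowth := by
  fun_prop

/-- Abstract Schwartz-level reproduction: if `(∑_j 2πi⟪ξ,b_j⟫ B_j) A = A` pointwise then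
`∑_j ∂_{b_j}(𝓕⁻¹A) ⋆ 𝓕⁻¹B_j = 𝓕⁻¹A`. -/
theorem sum_convolution_lineDeriv_eq {n : ℕ} (A : 𝓢(V, ℂ)) (B : Fin n → 𝓢(V, ℂ)) (b : Fin n → V)
    (h : ∀ ξ, (∑ j, (2 * π * I * ⟪ξ, b j⟫) * B j ξ) * A ξ = A ξ) :
    ∑ j, SchwartzMap.convolution (ContinuousLinearMap.mul ℂ ℂ) (∂_{b j} (𝓕⁻ A)) (𝓕⁻ (B j))
      = 𝓕⁻ A := by
  have key : 𝓕 (∑ j, SchwartzMap.convolution (ContinuousLinearMap.mul ℂ ℂ) (∂_{b j} (𝓕⁻ A))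
      (𝓕⁻ (B j))) = 𝓕 (𝓕⁻ A) := by
    rw [FourierTransform.fourier_fourierInv_eq]
    have : 𝓕 (∑ j, SchwartzMap.convolution (ContinuousLinearMap.mul ℂ ℂ) (∂_{b j} (𝓕⁻ A))
        (𝓕⁻ (B j))) = ∑ j, 𝓕 (SchwartzMap.convolution (ContinuousLinearMap.mul ℂ ℂ)
        (∂_{b j} (𝓕⁻ A)) (𝓕⁻ (B j))) := by
      rw [← fourierTransformCLM_apply (𝕜 := ℂ), map_sum]
      rfl
    rw [this]
    ext ξ
    simp only [SchwartzMap.fourier_convolution, FourierTransform.fourier_fourierInv_eq,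
      fourier_lineDerivOp_eq, sum_apply, pairing_apply_apply,
      smul_apply, smulLeftCLM_apply_apply (hasTemperateGrowth_inner_left _),
      ContinuousLinearMap.mul_apply', smul_eq_mul, real_smul]
    have h' := h ξ
    rw [Finset.sum_mul] at h'
    refine Eq.trans (Finset.sum_congr rfl fun j _ => ?_) h'
    ring
  simpa using congrArg (fun g : 𝓢(V, ℂ) => 𝓕⁻ g) key

variable (V) in
/-- `Φ_{ε,N} := 𝓕⁻¹ A_{ε,N}` (complex Schwartz). -/
def PhiS (hε : 0 < ε) (hN : ε < N) : 𝓢(V, ℂ) := 𝓕⁻ (symAS V hε hN)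

variable (V) in
/-- `𝒦_v := 𝓕⁻¹ B_v` (complex Schwartz). -/
def KS (hε : 0 < ε) (hN : ε < N) (v : V) : 𝓢(V, ℂ) := 𝓕⁻ (symBS V hε hN v)

/-- The Schwartz-level identity `∑_j ∂_{b_j}Φ ⋆ 𝒦_{b_j} = Φ`. -/
theorem sum_convolution_PhiS (hε : 0 < ε) (hN : ε < N) :
    ∑ j, SchwartzMap.convolution (ContinuousLinearMap.mul ℂ ℂ)
      (∂_{stdOrthonormalBasis ℝ V j} (PhiS V hε hN)) (KS V hε hN (stdOrthonormalBasis ℝ V j)) = PhiS V hε hN :=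
  sum_convolution_lineDeriv_eq _ _ _ (sum_symbol hε hN)

/-- Function-level complex identity: `Φ(x) = ∑_j ∫ 𝒦_j(y) ∂_{b_j}Φ(x − y) dy`. -/
theorem PhiS_eq_sum (hε : 0 < ε) (hN : ε < N) (x : V) :
    PhiS V hε hN x = ∑ j, ∫ y, KS V hε hN (stdOrthonormalBasis ℝ V j) y *
      (∂_{stdOrthonormalBasis ℝ V j} (PhiS V hε hN)) (x - y) := by
  have h := congrArg (fun f : 𝓢(V, ℂ) => f x) (sum_convolution_PhiS hε hN)
  simp only [sum_apply] at h
  rw [← h]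
  refine Finset.sum_congr rfl fun j _ => ?_
  rw [SchwartzMap.convolution_apply, MeasureTheory.convolution_def]
  simp only [ContinuousLinearMap.mul_apply']
  rw [← integral_sub_left_eq_self _ volume x]
  congr 1
  ext y
  simp [mul_comm]

/-- Realness of `𝓕⁻¹` of a real even function. -/
theorem conj_fourierInv_eq (A : V → ℂ) (hA : ∀ v, conj (A v) = A v) (hAe : ∀ v, A (-v) = A v)
    (x : V) : conj (𝓕⁻ A x) = 𝓕⁻ A x := by
  rw [Real.fourierInv_eq, ← integral_conj]
  have : ∀ v, conj ((𝐞 ⟪v, x⟫) • A v) = 𝐞 ⟪-v, x⟫ • A (-v) := by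
    intro v
    rw [Circle.smul_def, Circle.smul_def, smul_eq_mul, smul_eq_mul, map_mul,
      ← Circle.coe_inv_eq_conj, ← AddChar.map_neg_eq_inv, hA, hAe, inner_neg_left]
  simp_rw [this]
  exact integral_neg_eq_self (fun v => 𝐞 ⟪v, x⟫ • A v) volume

/-- `Φ_{ε,N}` is real-valued. -/
theorem ofReal_re_PhiS (hε : 0 < ε) (hN : ε < N) (x : V) : (((PhiS V hε hN x).re : ℝ) : ℂ) = PhiS V hε hN x := by
  have h : PhiS V hε hN x = 𝓕⁻ (⇑(symAS V hε hN)) x := by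
    unfold PhiS
    rw [fourierInv_coe]
  have hc := conj_fourierInv_eq (⇑(symAS V hε hN)) (fun v => by rw [symAS_apply, Complex.conj_ofReal])
    (fun v => by rw [symAS_apply, symAS_apply, symA_neg]) x
  rw [h]
  exact Complex.conj_eq_iff_re.mp hc

end Fourier

end Summit.NavierStokesRegularity.NavierStokesRegularity.Theorems.PoloidalWindowDoorPoloidalWindowRigidityFourierKernels

end
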